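import Summits.AtomisticToContinuum.BoseEinsteinCondensation.Theorems.BECGroundStateSOSRimSqueezeDefs
import Summits.AtomisticToContinuum.BoseEinsteinCondensation.Theorems.BECCutLineWeakDisorderGroundStateRigidityLocBddAllDensities
import Summits.AtomisticToContinuum.BoseEinsteinCondensation.Theorems.BECSwapNoCatastropheSwapToZeroModeStability
import Summits.AtomisticToContinuum.BoseEinsteinCondensation.Theorems.BECHardSphereReductionHardCoreDominatesMaxOccupationStability
import Literature.MathematicalPhysics.QuantumManyBody.BoseGasThermodynamicLimitProofs
import Literature.MathematicalPhysics.QuantumManyBody.BoseGasDirichletWall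

/-!
# Route `BECGroundStateSOS`, crux `BoundaryTransferWeak` (stmt-AtomisticToContinuum-0827),
# line `rim-squeeze-monotone-coherence`: the hard-wall limit (L) reduced to near-minimiser transfer

Supports (does not close) stmt-AtomisticToContinuum-0827; auxiliary block of the registered stub
`stub_hardWallLimit` (L) of the line skeleton
`Cruxes/BoundaryTransferWeak/Lines/rim_squeeze_monotone_coherence.lean` (lead c3), over the landed
ramp vocabulary `Theorems/BECGroundStateSOSRimSqueezeDefs.lean` (`rimPot`, `coreMode`, `rimEnergy`,
`rampEnergy`, `rampGroundStateEnergy`, `rampOccupation`, `coreOcc`).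

(L) says: at fixed `N` (large), `limsup_{t → ∞} coreOcc v t N ρ' ≤ coreOcc v ⊤ N ρ'`, where
`coreOcc v t N ρ' = sup_δ inf {⟨χ_C, γ_Ψ χ_C⟩ : Ψ a δ-near-minimiser of H_t = H^per + t Σ_j 1_rim(x_j)}`
on the torus of side `L' = sideLength ρ' N`, and `t = ⊤` is the Dirichlet cube of side `L'/2`.
This file proves the SOFT HALF of (L) completely and isolates its analytic content in ONE
hypothesis:

* `rampOccupation_le_rampOccupation_top_add` — **the assembly at fixed `N`.** For any one-body
  potential `w`, any normalised cell mode `φ` and any Dirichlet reference problem `(N, ℓ)` with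
  finite energy whose near-minimisers are RIGID (any two `δ`-near-minimisers are `η`-close in `L²`
  up to a phase — the conclusion of stmt-9072's `rigid_of_essLocBdd'`), IF the `δ₀`-near-minimisers
  of `H_t` for all `t ≥ t₀` (including `t = ⊤`) are `ε`-close in `L²((ℝ³)^N)` to `δ'`-near-minimisers
  of the Dirichlet problem (hypothesis **near-minimiser transfer across the hard wall**), THEN
  `rampOccupation(t) ≤ rampOccupation(⊤) + η` for all `t ≥ t₀(η)`. Proof: fix a reference Dirichlet
  near-minimiser `Φ_r`; by transfer + rigidity every near-minimiser of `H_t` (`t ≥ t₀`) and of `H_⊤`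
  is `2κ`-close to a phase times `Φ_r`, and `√occ_φ` is a seminorm dominated by `√N ‖·‖₂`
  (`SwapToZeroMode.occupation_rpow_half_le_add`), so both `sup_δ inf` are within `η/2` of
  `occ_φ(Φ_r)`; no uniqueness beyond rigidity and no compactness is used here.
* `coreOcc_le_coreOcc_top_add_of_transfer` — the same for `coreOcc` (Dirichlet side `L'/2`), with
  rigidity as a hypothesis (the form usable for hard cores, where rigidity is conditional).
* `stub_hardWallLimit_aux` — **(L) for the locally bounded class from transfer alone**: for `v`
  repulsive finite-range and bounded on every `(δ, ∞)`, rigidity and finiteness of the Dirichlet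
  cube are in the tree at every `(N ≥ 1, side > 0)` (`rigid_of_essLocBdd'`,
  `groundStateEnergy_ne_top_of_locBdd`), so the registered statement of (L) follows from the
  transfer hypothesis, verbatim.
* Cheap energy facts the transfer needs: `rampGroundStateEnergy_le_groundStateEnergy`
  (`E_t ≤ E₀^D(N, ℓ)` for `ℓ ≤ L/2`, `ℓ + R₀ ≤ L`: periodise a Dirichlet state, it pays no rim term —
  `rimEnergy_toPeriodic_eq_zero`) and `rimMass_le_of_rampEnergy_le` (a `δ`-near-minimiser of `H_t`
  has rim mass `≤ (E_t + δ)/t`).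

What remains of (L) is exactly the transfer hypothesis (third hypothesis of `stub_hardWallLimit_aux`):
at `t = ⊤` it is the cut of a rim-vanishing periodic `C¹` state to the cube (stub (D)); at finite
`t ≥ t₀` it is a rim-layer cutoff (cost `rim mass / h² ≤ (E₀^D + δ₀)/(t h²)`) followed by a shrink of
the fattened cube `ℓ + 2h ↦ ℓ` (right-continuity of the Dirichlet problem in the side, with state
control) — Simon's monotone convergence for the forms `H_t ↑ H_⊤`. All `[folklore]`.
-/

noncomputable section

namespace Summit.AtomisticToContinuum.BoseEinsteinCondensation.RimSqueeze

open Literature.MathematicalPhysics.QuantumManyBody.BoseGas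
open MeasureTheory Filter Set
open scoped ENNReal NNReal ComplexConjugate
open Summit.AtomisticToContinuum.BoseEinsteinCondensation.Theorems
  (SwapToZeroMode.occupation_rpow_half_le_add)
open Summit.AtomisticToContinuum.BoseEinsteinCondensation.Cruxes.HardCoreDominates.Birth
  (occupation_le_card_mul_lintegral_mul)
open Summit.AtomisticToContinuum.BoseEinsteinCondensation.Theorems.GroundStateRigidity
  (rigid_of_essLocBdd' groundStateEnergy_ne_top_of_locBdd)

variable {N : ℕ} {L : ℝ}

/-! ### Cheap energy facts along the ramp -/

/-- **A periodised Dirichlet state of a cube of side `ℓ ≤ L/2` pays no rim term**: on the cell it is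
the Dirichlet state, supported where every coordinate is `< ℓ ≤ L/2`, off the rim. [folklore] -/
theorem rimEnergy_toPeriodic_eq_zero {ℓ : ℝ} (hL : 0 < L) (hℓ : ℓ ≤ L) (hℓ2 : ℓ ≤ L / 2)
    (Φ : TrialState N ℓ) (t : ℝ≥0∞) : rimEnergy (rimPot L) t (Φ.toPeriodic hL hℓ) = 0 := by
  unfold rimEnergy
  suffices h : ∫⁻ X in cellN N L,
      (∑ j, rimPot L (X j)) * (‖(Φ.toPeriodic hL hℓ).ψ X‖₊ : ℝ≥0∞) ^ 2 = 0 by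
    rw [h, mul_zero]
  refine (setLIntegral_congr_fun (measurableSet_cellN N L) (fun X hX => ?_)).trans
    (by rw [lintegral_zero] : ∫⁻ _ in cellN N L, (0 : ℝ≥0∞) = 0)
  show (∑ j, rimPot L (X j)) * (‖periodize L Φ.ψ X‖₊ : ℝ≥0∞) ^ 2 = 0
  rw [periodize_of_mem_cellN hL Φ.ψ hX]
  by_cases hXb : X ∈ boxN N ℓ
  · have hsum : ∑ j, rimPot L (X j) = 0 := by
      refine Finset.sum_eq_zero fun j _ => ?_
      rw [rimPot_apply, if_neg]
      rintro ⟨k, hk⟩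
      have := (hXb j k).2
      linarith
    rw [hsum, zero_mul]
  · rw [Φ.eq_zero X hXb]
    simp

/-- Along the whole ramp (any `t ∈ [0, ∞]`) the periodised Dirichlet state of the cube of side
`ℓ ≤ L/2` with `ℓ + R₀ ≤ L` has ramp energy at most its Dirichlet energy (no rim term, no image
interactions). [folklore] -/
theorem rampEnergy_toPeriodic_le {v : ℝ → ℝ≥0∞} {R₀ ℓ : ℝ} (hv : ∀ r, R₀ < r → v r = 0)
    (hL : 0 < L) (hℓ : ℓ ≤ L) (hℓ2 : ℓ ≤ L / 2) (hR : ℓ + R₀ ≤ L) (Φ : TrialState N ℓ) (t : ℝ≥0∞) :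
    rampEnergy v (rimPot L) t (Φ.toPeriodic hL hℓ) ≤ energy v Φ := by
  rw [rampEnergy, rimEnergy_toPeriodic_eq_zero hL hℓ hℓ2 Φ t, add_zero]
  exact Φ.periodicEnergy_toPeriodic_le hv hL hℓ hR

/-- **`RampBelowDirichlet`: `E_t ≤ E₀^D(N, ℓ)` for every `t ∈ [0, ∞]`**, for a cube of side
`ℓ ≤ L/2` padded by the range (`ℓ + R₀ ≤ L`); in particular `E_⊤ ≤ E₀^D(N, L/2)` once `2R₀ ≤ L`
(the cheap half of the identification of the `t = ⊤` endpoint with the Dirichlet cube). [folklore] -/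
theorem rampGroundStateEnergy_le_groundStateEnergy {v : ℝ → ℝ≥0∞} {R₀ ℓ : ℝ}
    (hv : ∀ r, R₀ < r → v r = 0) (hL : 0 < L) (hℓ : ℓ ≤ L) (hℓ2 : ℓ ≤ L / 2) (hR : ℓ + R₀ ≤ L)
    (t : ℝ≥0∞) (N : ℕ) : rampGroundStateEnergy v (rimPot L) t N L ≤ groundStateEnergy v N ℓ :=
  le_iInf fun Φ => (rampGroundStateEnergy_le v _ t (Φ.toPeriodic hL hℓ)).trans
    (rampEnergy_toPeriodic_le hv hL hℓ hℓ2 hR Φ t)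

/-- **Rim mass of a near-minimiser**: if `rampEnergy v w t Ψ ≤ E_t + δ` with `0 < t < ∞` then the
weighted rim mass of `Ψ` is at most `(E_t + δ)/t` (it tends to `0` along the ramp as soon as `E_t`
stays bounded, e.g. by `E₀^D`). [folklore] -/
theorem rimMass_le_of_rampEnergy_le {v : ℝ → ℝ≥0∞} {w : Space → ℝ≥0∞} {t δ : ℝ≥0∞} (ht : t ≠ 0)
    (ht' : t ≠ ⊤) (Ψ : PeriodicTrialState N L)
    (h : rampEnergy v w t Ψ ≤ rampGroundStateEnergy v w t N L + δ) :
    ∫⁻ X in cellN N L, (∑ j, w (X j)) * (‖Ψ.ψ X‖₊ : ℝ≥0∞) ^ 2 ≤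
      (rampGroundStateEnergy v w t N L + δ) / t := by
  rw [ENNReal.le_div_iff_mul_le (Or.inl ht) (Or.inl ht'), mul_comm]
  exact (le_add_self).trans h

/-! ### Near-minimisers exist at every positive slack -/

/-- At every positive slack the ramp problem has a near-minimiser (any state if `E_t = ⊤`).
[folklore] -/
theorem exists_rampEnergy_le [Nonempty (PeriodicTrialState N L)] (v : ℝ → ℝ≥0∞)
    (w : Space → ℝ≥0∞) (t : ℝ≥0∞) {δ : ℝ≥0∞} (hδ : δ ≠ 0) :
    ∃ Ψ : PeriodicTrialState N L, rampEnergy v w t Ψ ≤ rampGroundStateEnergy v w t N L + δ := by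
  by_cases htop : rampGroundStateEnergy v w t N L = ⊤
  · exact ⟨Classical.arbitrary _, by rw [htop, top_add]; exact le_top⟩
  · have hlt : (⨅ Ψ : PeriodicTrialState N L, rampEnergy v w t Ψ) <
        rampGroundStateEnergy v w t N L + δ := ENNReal.lt_add_right htop hδ
    obtain ⟨Ψ, hΨ⟩ := iInf_lt_iff.1 hlt
    exact ⟨Ψ, hΨ.le⟩

/-- At every positive slack a finite-energy Dirichlet problem has a near-minimiser. [folklore] -/
theorem exists_energy_le {ℓ : ℝ} (v : ℝ → ℝ≥0∞) (hE : groundStateEnergy v N ℓ ≠ ⊤) {δ : ℝ≥0∞}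
    (hδ : δ ≠ 0) : ∃ Φ : TrialState N ℓ, energy v Φ ≤ groundStateEnergy v N ℓ + δ := by
  have hlt : (⨅ Φ : TrialState N ℓ, energy v Φ) < groundStateEnergy v N ℓ + δ :=
    ENNReal.lt_add_right hE hδ
  obtain ⟨Φ, hΦ⟩ := iInf_lt_iff.1 hlt
  exact ⟨Φ, hΦ.le⟩

/-! ### `L²` bookkeeping -/

/-- Triangle inequality in `L²((ℝ³)^N)` for the `ℝ≥0∞` square distances. [folklore] -/
theorem l2dist_triangle {f g h : Config N → ℂ} (hf : Measurable f) (hg : Measurable g)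
    (hh : Measurable h) :
    (∫⁻ X, (‖f X - h X‖₊ : ℝ≥0∞) ^ 2) ^ (1 / 2 : ℝ) ≤
      (∫⁻ X, (‖f X - g X‖₊ : ℝ≥0∞) ^ 2) ^ (1 / 2 : ℝ) +
        (∫⁻ X, (‖g X - h X‖₊ : ℝ≥0∞) ^ 2) ^ (1 / 2 : ℝ) := by
  have hF : AEMeasurable (fun X => (‖f X - g X‖₊ : ℝ≥0∞)) volume :=
    (hf.sub hg).nnnorm.coe_nnreal_ennreal.aemeasurable
  have hG : AEMeasurable (fun X => (‖g X - h X‖₊ : ℝ≥0∞)) volume :=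
    (hg.sub hh).nnnorm.coe_nnreal_ennreal.aemeasurable
  have hmink := ENNReal.lintegral_Lp_add_le hF hG (by norm_num : (1 : ℝ) ≤ 2)
  simp only [Pi.add_apply, ENNReal.rpow_two] at hmink
  refine le_trans ?_ hmink
  gcongr with X
  calc (‖f X - h X‖₊ : ℝ≥0∞) = ‖(f X - g X) + (g X - h X)‖₊ := by rw [sub_add_sub_cancel]
    _ ≤ ‖f X - g X‖₊ + ‖g X - h X‖₊ := by exact_mod_cast nnnorm_add_le _ _

/-- The `L²` square distance is symmetric. [folklore] -/
theorem l2dist_comm (f g : Config N → ℂ) :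
    ∫⁻ X, (‖f X - g X‖₊ : ℝ≥0∞) ^ 2 = ∫⁻ X, (‖g X - f X‖₊ : ℝ≥0∞) ^ 2 :=
  lintegral_congr fun X => by rw [← neg_sub (g X) (f X), nnnorm_neg]

/-- `∫ |cΦ - cG|² = ∫ |Φ - G|²` for a phase `|c| = 1`. [folklore] -/
theorem l2dist_const_mul {c : ℂ} (hc : ‖c‖ = 1) (Φ G : Config N → ℂ) :
    ∫⁻ X, (‖c * Φ X - c * G X‖₊ : ℝ≥0∞) ^ 2 = ∫⁻ X, (‖Φ X - G X‖₊ : ℝ≥0∞) ^ 2 :=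
  lintegral_congr fun X => by
    rw [← mul_sub, nnnorm_mul, ENNReal.coe_mul, coe_nnnorm_eq_one_of_norm_eq_one hc, one_mul]

/-- A square distance `≤ κ²` is a distance `≤ κ`. [folklore] -/
theorem l2dist_rpow_half_le {d : ℝ≥0∞} {κ : ℝ} (hκ : 0 ≤ κ) (h : d ≤ ENNReal.ofReal (κ ^ 2)) :
    d ^ (1 / 2 : ℝ) ≤ ENNReal.ofReal κ := by
  calc d ^ (1 / 2 : ℝ) ≤ (ENNReal.ofReal (κ ^ 2)) ^ (1 / 2 : ℝ) := by gcongr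
    _ = ENNReal.ofReal κ := by rw [ofReal_rpow_half_eq_sqrt (sq_nonneg κ), Real.sqrt_sq hκ]

/-- The cell cut-off `1_{cell^N} Ψ` of a periodic trial state is normalised on `(ℝ³)^N`. [folklore] -/
theorem lintegral_indicator_cellN_sq (Ψ : PeriodicTrialState N L) :
    ∫⁻ X, (‖(cellN N L).indicator Ψ.ψ X‖₊ : ℝ≥0∞) ^ 2 = 1 := by
  have h : (fun X => (‖(cellN N L).indicator Ψ.ψ X‖₊ : ℝ≥0∞) ^ 2) =
      (cellN N L).indicator fun X => (‖Ψ.ψ X‖₊ : ℝ≥0∞) ^ 2 := by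
    funext X
    by_cases hX : X ∈ cellN N L
    · simp [Set.indicator_of_mem hX]
    · simp [Set.indicator_of_notMem hX]
  rw [h, lintegral_indicator (measurableSet_cellN N L), Ψ.norm_eq]

/-- `occ_φ(G)^{1/2} ≤ √N` for a normalised mode and a normalised `G`. [folklore] -/
theorem occupation_rpow_half_le {φ : Space → ℂ} (hφ : AEStronglyMeasurable φ volume)
    (hφ1 : ∫⁻ x, (‖φ x‖₊ : ℝ≥0∞) ^ 2 = 1) {G : Config N → ℂ} (hG : Measurable G)
    (hG1 : ∫⁻ X, (‖G X‖₊ : ℝ≥0∞) ^ 2 = 1) :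
    occupation N φ G ^ (1 / 2 : ℝ) ≤ (N : ℝ≥0∞) ^ (1 / 2 : ℝ) := by
  refine ENNReal.rpow_le_rpow ?_ (by norm_num)
  calc occupation N φ G
      ≤ (N : ℝ≥0∞) * (∫⁻ x, (‖φ x‖₊ : ℝ≥0∞) ^ 2) * ∫⁻ X, (‖G X‖₊ : ℝ≥0∞) ^ 2 :=
        occupation_le_card_mul_lintegral_mul hφ.aemeasurable hG
    _ = N := by rw [hφ1, hG1, mul_one, mul_one]

/-! ### The assembly at fixed `N` -/

/-- **Hard-wall limit from near-minimiser transfer and Dirichlet rigidity (fixed `N ≥ 1`).** Let `w`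
be a one-body potential on the torus of side `L`, `φ` a normalised mode of the cell, and `(N, ℓ)` a
Dirichlet reference problem with `E₀^D(N, ℓ) < ⊤` whose near-minimisers are rigid (`hR`). If for
every Dirichlet slack `δ' > 0` and `ε > 0` there are `t₀`, `δ₀ > 0` such that every `δ₀`-near-minimiser
`Ψ` of `H_t`, `t₀ ≤ t ≤ ⊤`, admits a `δ'`-near-minimiser `Φ` of the Dirichlet problem with
`∫ |Φ - 1_{cell^N}Ψ|² ≤ ε` (`hT`, near-minimiser transfer across the hard wall), then for every
`η > 0`: `rampOccupation(t) ≤ rampOccupation(⊤) + η` for all `t ≥ t₀(η)`. [folklore] -/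
theorem rampOccupation_le_rampOccupation_top_add (hN : 1 ≤ N) {ℓ : ℝ} (v : ℝ → ℝ≥0∞)
    (w : Space → ℝ≥0∞) {φ : Space → ℂ} (hφ : AEStronglyMeasurable φ volume)
    (hφ1 : ∫⁻ x, (‖φ x‖₊ : ℝ≥0∞) ^ 2 = 1) (hφc : (cell L).indicator φ = φ)
    (hE : groundStateEnergy v N ℓ ≠ ⊤)
    (hR : ∀ η : ℝ, 0 < η → ∃ δ : ℝ≥0∞, 0 < δ ∧ ∀ Ψ Φ : TrialState N ℓ,
      energy v Ψ ≤ groundStateEnergy v N ℓ + δ → energy v Φ ≤ groundStateEnergy v N ℓ + δ →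
      ∃ c : ℂ, ‖c‖ = 1 ∧ ∫⁻ X, (‖Ψ.ψ X - c * Φ.ψ X‖₊ : ℝ≥0∞) ^ 2 ≤ ENNReal.ofReal η)
    (hT : ∀ δ' : ℝ≥0∞, 0 < δ' → ∀ ε : ℝ, 0 < ε → ∃ t₀ : ℝ≥0, ∃ δ₀ : ℝ≥0∞, 0 < δ₀ ∧
      ∀ t : ℝ≥0∞, (t₀ : ℝ≥0∞) ≤ t → ∀ Ψ : PeriodicTrialState N L,
        rampEnergy v w t Ψ ≤ rampGroundStateEnergy v w t N L + δ₀ →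
        ∃ Φ : TrialState N ℓ, energy v Φ ≤ groundStateEnergy v N ℓ + δ' ∧
          ∫⁻ X, (‖Φ.ψ X - (cellN N L).indicator Ψ.ψ X‖₊ : ℝ≥0∞) ^ 2 ≤ ENNReal.ofReal ε) :
    ∀ η : ℝ, 0 < η → ∃ t₀ : ℝ≥0, ∀ t : ℝ≥0∞, (t₀ : ℝ≥0∞) ≤ t →
      rampOccupation v w t N L φ ≤ rampOccupation v w ⊤ N L φ + ENNReal.ofReal η := by
  intro η hη
  obtain ⟨n, rfl⟩ : ∃ n, N = n + 1 := ⟨N - 1, by omega⟩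
  rcases isEmpty_or_nonempty (PeriodicTrialState (n + 1) L) with hemp | hne
  · -- no periodic trial states: both occupations are `⊤`
    refine ⟨0, fun t _ => ?_⟩
    have htop : rampOccupation v w ⊤ (n + 1) L φ = ⊤ := by
      refine le_antisymm le_top ?_
      refine le_rampOccupation v w ⊤ φ (m := ⊤) one_pos fun Ψ _ => ?_
      exact (hemp.false Ψ).elim
    rw [htop, top_add]
    exact le_top
  -- parameters: `κ = η/(8N)`, rigidity and transfer at tolerance `κ²`
  set Nr : ℝ := ((n + 1 : ℕ) : ℝ) with hNr
  have hN0 : (0 : ℝ) < Nr := by rw [hNr]; positivity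
  set κ : ℝ := η / (8 * Nr) with hκ
  have hκ0 : 0 < κ := by positivity
  have hκ2 : 0 < κ ^ 2 := by positivity
  obtain ⟨δR, hδR, hrig⟩ := hR (κ ^ 2) hκ2
  obtain ⟨t₀, δ₀, hδ₀, htr⟩ := hT δR hδR (κ ^ 2) hκ2
  obtain ⟨Φr, hΦr⟩ := exists_energy_le v hE hδR.ne'
  refine ⟨t₀, fun t ht => ?_⟩
  -- bookkeeping identities
  have hocc : ∀ Ψ : PeriodicTrialState (n + 1) L, cellOccupation (n + 1) L φ Ψ.ψ =
      occupation (n + 1) φ ((cellN (n + 1) L).indicator Ψ.ψ) := fun Ψ => by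
    rw [cellOccupation, hφc]
  have hGm : ∀ Ψ : PeriodicTrialState (n + 1) L,
      Measurable ((cellN (n + 1) L).indicator Ψ.ψ) := fun Ψ =>
    Ψ.contDiff.continuous.measurable.indicator (measurableSet_cellN _ _)
  have hΦm : ∀ Φ : TrialState (n + 1) ℓ, Measurable Φ.ψ := fun Φ =>
    Φ.contDiff.continuous.measurable
  have hsq : ∀ x : ℝ≥0∞, (x ^ (1 / 2 : ℝ)) ^ 2 = x := fun x => by
    rw [← ENNReal.rpow_two, ← ENNReal.rpow_mul]
    norm_num
  have herr : 2 * (((n + 1 : ℕ) : ℝ≥0∞) ^ (1 / 2 : ℝ) * ((n + 1 : ℕ) : ℝ≥0∞) ^ (1 / 2 : ℝ)) *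
      (ENNReal.ofReal κ + ENNReal.ofReal κ) = ENNReal.ofReal (η / 2) := by
    rw [← sq, hsq, ← ENNReal.ofReal_add hκ0.le hκ0.le, ← ENNReal.ofReal_natCast,
      ← ENNReal.ofReal_ofNat, ← ENNReal.ofReal_mul zero_le_two,
      ← ENNReal.ofReal_mul (by positivity)]
    congr 1
    rw [hκ, ← hNr]
    field_simp
    ring
  have hb : occupation (n + 1) φ Φr.ψ ^ (1 / 2 : ℝ) ≤ ((n + 1 : ℕ) : ℝ≥0∞) ^ (1 / 2 : ℝ) :=
    occupation_rpow_half_le hφ hφ1 (hΦm Φr) Φr.norm_eq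
  -- UPPER estimate: every `δ₀`-near-minimiser of `H_s`, `s ≥ t₀`, has `occ ≤ occ(Φ_r) + η/2`
  have upper : ∀ s : ℝ≥0∞, (t₀ : ℝ≥0∞) ≤ s → ∀ Ψ : PeriodicTrialState (n + 1) L,
      rampEnergy v w s Ψ ≤ rampGroundStateEnergy v w s (n + 1) L + δ₀ →
      occupation (n + 1) φ ((cellN (n + 1) L).indicator Ψ.ψ) ≤
        occupation (n + 1) φ Φr.ψ + ENNReal.ofReal (η / 2) := by
    intro s hs Ψ hΨ
    obtain ⟨Φ, hΦE, hΦd⟩ := htr s hs Ψ hΨ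
    obtain ⟨c, hc, hcd⟩ := hrig Φ Φr hΦE hΦr
    have h1 : (∫⁻ X, (‖(cellN (n + 1) L).indicator Ψ.ψ X - Φ.ψ X‖₊ : ℝ≥0∞) ^ 2) ^ (1 / 2 : ℝ) ≤
        ENNReal.ofReal κ := l2dist_rpow_half_le hκ0.le (by rwa [l2dist_comm])
    have h2 : (∫⁻ X, (‖Φ.ψ X - c * Φr.ψ X‖₊ : ℝ≥0∞) ^ 2) ^ (1 / 2 : ℝ) ≤ ENNReal.ofReal κ :=
      l2dist_rpow_half_le hκ0.le hcd
    have hd := (l2dist_triangle (hGm Ψ) (hΦm Φ) (measurable_const.mul (hΦm Φr))).trans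
      (add_le_add h1 h2)
    have habd := SwapToZeroMode.occupation_rpow_half_le_add hφ hφ1 (hGm Ψ) (hΦm Φr) hc
    have ha : occupation (n + 1) φ ((cellN (n + 1) L).indicator Ψ.ψ) ^ (1 / 2 : ℝ) ≤
        ((n + 1 : ℕ) : ℝ≥0∞) ^ (1 / 2 : ℝ) :=
      occupation_rpow_half_le hφ hφ1 (hGm Ψ) (lintegral_indicator_cellN_sq Ψ)
    have key := sq_le_sq_add_of_le_add habd ha hb (mul_le_mul_right hd _)
    rwa [hsq, hsq, herr] at key
  -- LOWER estimate: every `δ₀`-near-minimiser of `H_⊤` has `occ(Φ_r) ≤ occ + η/2`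
  have lower : ∀ Ψ : PeriodicTrialState (n + 1) L,
      rampEnergy v w ⊤ Ψ ≤ rampGroundStateEnergy v w ⊤ (n + 1) L + δ₀ →
      occupation (n + 1) φ Φr.ψ ≤
        occupation (n + 1) φ ((cellN (n + 1) L).indicator Ψ.ψ) + ENNReal.ofReal (η / 2) := by
    intro Ψ hΨ
    obtain ⟨Φ, hΦE, hΦd⟩ := htr ⊤ le_top Ψ hΨ
    obtain ⟨c, hc, hcd⟩ := hrig Φr Φ hΦr hΦE
    have h1 : (∫⁻ X, (‖Φr.ψ X - c * Φ.ψ X‖₊ : ℝ≥0∞) ^ 2) ^ (1 / 2 : ℝ) ≤ ENNReal.ofReal κ :=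
      l2dist_rpow_half_le hκ0.le hcd
    have h2 : (∫⁻ X, (‖c * Φ.ψ X - c * (cellN (n + 1) L).indicator Ψ.ψ X‖₊ : ℝ≥0∞) ^ 2) ^
        (1 / 2 : ℝ) ≤ ENNReal.ofReal κ :=
      l2dist_rpow_half_le hκ0.le (by rwa [l2dist_const_mul hc])
    have hd := (l2dist_triangle (hΦm Φr) (measurable_const.mul (hΦm Φ))
      (measurable_const.mul (hGm Ψ))).trans (add_le_add h1 h2)
    have habd := SwapToZeroMode.occupation_rpow_half_le_add hφ hφ1 (hΦm Φr) (hGm Ψ) hc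
    have ha : occupation (n + 1) φ ((cellN (n + 1) L).indicator Ψ.ψ) ^ (1 / 2 : ℝ) ≤
        ((n + 1 : ℕ) : ℝ≥0∞) ^ (1 / 2 : ℝ) :=
      occupation_rpow_half_le hφ hφ1 (hGm Ψ) (lintegral_indicator_cellN_sq Ψ)
    have key := sq_le_sq_add_of_le_add habd hb ha (mul_le_mul_right hd _)
    rwa [hsq, hsq, herr] at key
  -- the `sup_δ inf` plumbing
  have hup : rampOccupation v w t (n + 1) L φ ≤
      occupation (n + 1) φ Φr.ψ + ENNReal.ofReal (η / 2) := by
    refine iSup₂_le fun δ hδ => ?_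
    obtain ⟨Ψ, hΨ⟩ := exists_rampEnergy_le (N := n + 1) (L := L) v w t (δ := min δ δ₀) (lt_min hδ hδ₀).ne'
    refine (iInf₂_le Ψ (hΨ.trans (add_le_add le_rfl (min_le_left _ _)))).trans ?_
    rw [hocc]
    exact upper t ht Ψ (hΨ.trans (add_le_add le_rfl (min_le_right _ _)))
  have hlow : occupation (n + 1) φ Φr.ψ ≤
      rampOccupation v w ⊤ (n + 1) L φ + ENNReal.ofReal (η / 2) := by
    have h1 : occupation (n + 1) φ Φr.ψ ≤ (⨅ (Ψ : PeriodicTrialState (n + 1) L)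
        (_ : rampEnergy v w ⊤ Ψ ≤ rampGroundStateEnergy v w ⊤ (n + 1) L + δ₀),
          cellOccupation (n + 1) L φ Ψ.ψ) + ENNReal.ofReal (η / 2) := by
      rw [ENNReal.iInf_add]
      refine le_iInf fun Ψ => ?_
      rw [ENNReal.iInf_add]
      refine le_iInf fun hΨ => ?_
      rw [hocc]
      exact lower Ψ hΨ
    have h2 : (⨅ (Ψ : PeriodicTrialState (n + 1) L)
        (_ : rampEnergy v w ⊤ Ψ ≤ rampGroundStateEnergy v w ⊤ (n + 1) L + δ₀),
          cellOccupation (n + 1) L φ Ψ.ψ) ≤ rampOccupation v w ⊤ (n + 1) L φ :=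
      le_rampOccupation v w ⊤ φ hδ₀ fun Ψ h => iInf₂_le Ψ h
    exact h1.trans (add_le_add h2 le_rfl)
  calc rampOccupation v w t (n + 1) L φ
      ≤ occupation (n + 1) φ Φr.ψ + ENNReal.ofReal (η / 2) := hup
    _ ≤ rampOccupation v w ⊤ (n + 1) L φ + ENNReal.ofReal (η / 2) + ENNReal.ofReal (η / 2) :=
        add_le_add hlow le_rfl
    _ = rampOccupation v w ⊤ (n + 1) L φ + ENNReal.ofReal η := by
        rw [add_assoc, ← ENNReal.ofReal_add (by positivity) (by positivity), add_halves]

/-- **(L) at fixed `N` from transfer and rigidity** (the form usable for every admissible `v`, hard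
cores included, where Dirichlet rigidity is conditional): with `L' = sideLength ρ' N`, finite
Dirichlet energy and rigid near-minimisers in the cube of side `L'/2`, and near-minimiser transfer
across the hard wall at this `N`, for every `η > 0` some `t₀` gives
`coreOcc v t N ρ' ≤ coreOcc v ⊤ N ρ' + η` for all finite `t ≥ t₀`. [folklore] -/
theorem coreOcc_le_coreOcc_top_add_of_transfer (hN : 1 ≤ N) {ρ' : ℝ} (hρ' : 0 < ρ')
    (v : ℝ → ℝ≥0∞) (hE : groundStateEnergy v N (sideLength ρ' N / 2) ≠ ⊤)
    (hR : ∀ η : ℝ, 0 < η → ∃ δ : ℝ≥0∞, 0 < δ ∧ ∀ Ψ Φ : TrialState N (sideLength ρ' N / 2),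
      energy v Ψ ≤ groundStateEnergy v N (sideLength ρ' N / 2) + δ →
      energy v Φ ≤ groundStateEnergy v N (sideLength ρ' N / 2) + δ →
      ∃ c : ℂ, ‖c‖ = 1 ∧ ∫⁻ X, (‖Ψ.ψ X - c * Φ.ψ X‖₊ : ℝ≥0∞) ^ 2 ≤ ENNReal.ofReal η)
    (hT : ∀ δ' : ℝ≥0∞, 0 < δ' → ∀ ε : ℝ, 0 < ε → ∃ t₀ : ℝ≥0, ∃ δ₀ : ℝ≥0∞, 0 < δ₀ ∧
      ∀ t : ℝ≥0∞, (t₀ : ℝ≥0∞) ≤ t → ∀ Ψ : PeriodicTrialState N (sideLength ρ' N),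
        rampEnergy v (rimPot (sideLength ρ' N)) t Ψ ≤
            rampGroundStateEnergy v (rimPot (sideLength ρ' N)) t N (sideLength ρ' N) + δ₀ →
        ∃ Φ : TrialState N (sideLength ρ' N / 2),
          energy v Φ ≤ groundStateEnergy v N (sideLength ρ' N / 2) + δ' ∧
          ∫⁻ X, (‖Φ.ψ X - (cellN N (sideLength ρ' N)).indicator Ψ.ψ X‖₊ : ℝ≥0∞) ^ 2 ≤
            ENNReal.ofReal ε) :
    ∀ η : ℝ, 0 < η → ∃ t₀ : ℝ≥0, ∀ t : ℝ≥0, t₀ ≤ t →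
      coreOcc v (t : ℝ≥0∞) N ρ' ≤ coreOcc v ⊤ N ρ' + ENNReal.ofReal η := by
  intro η hη
  have hL : 0 < sideLength ρ' N := sideLength_pos_of_pos hρ' hN
  obtain ⟨t₀, ht₀⟩ := rampOccupation_le_rampOccupation_top_add hN v (rimPot (sideLength ρ' N))
    (aestronglyMeasurable_coreMode _) (lintegral_coreMode_sq hL) (indicator_cell_coreMode hL)
    hE hR hT η hη
  exact ⟨t₀, fun t ht => ht₀ t (ENNReal.coe_le_coe.2 ht)⟩

/-- **Stub (L) for the locally bounded class, from near-minimiser transfer alone** (anchor of this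
auxiliary block). For `v` repulsive, finite-range and bounded on every `(δ, ∞)` (soft cores at
`r → 0` allowed), the Dirichlet cube of side `L'/2` has finite energy and rigid near-minimisers at
every `N ≥ 1` (stmt-9072: `groundStateEnergy_ne_top_of_locBdd`, `rigid_of_essLocBdd'`), so the
registered statement of `stub_hardWallLimit` follows from the transfer hypothesis (third
hypothesis: below some density, eventually in `N`, the `δ₀`-near-minimisers of `H_t` for
`t₀ ≤ t ≤ ⊤` are `ε`-close in `L²` to `δ'`-near-minimisers of the Dirichlet cube). [folklore] -/
theorem stub_hardWallLimit_aux : ∀ v : ℝ → ℝ≥0∞, IsRepulsiveFiniteRange v → (∀ δ : ℝ, 0 < δ → ∃ M : ℝ≥0∞, M ≠ ⊤ ∧ ∀ r : ℝ, δ < r → v r ≤ M) → (∃ ρ₁ : ℝ, 0 < ρ₁ ∧ ∀ ρ' : ℝ, 0 < ρ' → ρ' < ρ₁ → ∀ᶠ N : ℕ in atTop, ∀ δ' : ℝ≥0∞, 0 < δ' → ∀ ε : ℝ, 0 < ε → ∃ t₀ : ℝ≥0, ∃ δ₀ : ℝ≥0∞, 0 < δ₀ ∧ ∀ t : ℝ≥0∞,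 (t₀ : ℝ≥0∞) ≤ t → ∀ Ψ : PeriodicTrialState N (sideLength ρ' N), rampEnergy v (rimPot (sideLength ρ' N)) t Ψ ≤ rampGroundStateEnergy v (rimPot (sideLength ρ' N)) t N (sideLength ρ' N) + δ₀ → ∃ Φ : TrialState N (sideLength ρ' N / 2), energy v Φ ≤ groundStateEnergy v N (sideLength ρ' N / 2) + δ' ∧ ∫⁻ X, (‖Φ.ψ X - (cellN N (sideLength ρ' N)).indicator Ψ.ψ X‖₊ : ℝ≥0∞) ^ 2 ≤ ENNReal.ofReal ε) → ∃ ρ₁ : ℝ, 0 < ρ₁ ∧ ∀ ρ' : ℝ, 0 < ρ' → ρ' < ρ₁ → ∀ᶠ N : ℕ in atTop, ∀ η : ℝ, 0 < η → ∃ t₀ : ℝ≥0, ∀ t : ℝ≥0, t₀ ≤ t → coreOcc v (t : ℝ≥0∞) N ρ' ≤ coreOcc v ⊤ N ρ' + ENNReal.ofReal η := by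
  rintro v hv hlb ⟨ρ₁, hρ₁, htr⟩
  refine ⟨ρ₁, hρ₁, fun ρ' hρ' hρ'₁ => ?_⟩
  filter_upwards [htr ρ' hρ' hρ'₁, eventually_ge_atTop 1] with N hT hN
  have hℓ : 0 < sideLength ρ' N / 2 := half_pos (sideLength_pos_of_pos hρ' hN)
  have hlb' : ∀ r : ℝ, 0 < r → ∃ C : ℝ≥0, ∀ s : ℝ, r ≤ s → v s ≤ C := by
    intro r hr
    obtain ⟨M, hM, hb⟩ := hlb (r / 2) (half_pos hr)
    exact ⟨M.toNNReal, fun s hs => (hb s (by linarith)).trans (ENNReal.coe_toNNReal hM).ge⟩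
  exact coreOcc_le_coreOcc_top_add_of_transfer hN hρ' v
    (groundStateEnergy_ne_top_of_locBdd N v _ hN hℓ hv.1 hlb')
    (rigid_of_essLocBdd' N v _ hN hℓ hv.1 fun r hr => (hlb' r hr).imp fun C hC => ae_of_all _ hC)
    hT

end Summit.AtomisticToContinuum.BoseEinsteinCondensation.RimSqueeze

end
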